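import Mathlib.NumberTheory.Primorial
import Mathlib.Algebra.BigOperators.Field
import Literature.IUT.LogVolume.Theorem110StepII
import HarnessLib

/-!
# [IUTchIV] Theorem 1.10, Step (iii) over the tower `F_mod ⊆ F_tpd`: the bound on `log(𝔰^ℚ)` (general case)

Mochizuki, *Inter-universal Teichmüller theory IV*, RIMS manuscript (Apr. 2020; = PRIMS **57** (2021)),
proof of Thm. 1.10, Step (iii), pp. 24–26. Setting (p. 22): `F_mod ⊆ F_tpd := F_mod(E_{F_mod}[2])` (so
`[F_tpd : ℚ] = [F_tpd : F_mod]·d_mod`, `d_mod = [F_mod : ℚ]`; `F_tpd/F_mod` is Galois). The distinguished rational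
primes are those that ramify in `K` ((D4) ⟺ (D5) ⟺ (D6): "Either `p_{v_ℚ} | 2·3·5·l` or `v_ℚ` lies in the image
of `Supp(𝔮^{F_tpd}_ADiv + 𝔡^{F_tpd}_ADiv)`"), `log(𝔰^ℚ) = Σ_{p dst} log p`, and (p. 26): "it follows immediately
from Proposition 1.3, (i), by considering the various possibilities for elements `∈ Supp(𝔰^{F_mod}_ADiv)`, that
`log(𝔰^{F_mod}_{v_ℚ}) ≤ 2·(log(𝔡^{F_tpd}_{v_ℚ}) + log(𝔣^{F_tpd}_{v_ℚ}))` … In a similar vein, we conclude that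
`log(𝔰^ℚ) ≤ 2·d_mod·(log(𝔡^{F_tpd}) + log(𝔣^{F_tpd})) + log(2·3·5·l)`".

This file kernel-checks that assembly over the two-level place data of `Theorem110StepII.lean` with `L₀ = F_mod`,
`L = F_tpd` (`Thm110StepII.PlaceData`: per place `v` of `F_mod`: `p_v, e_v, f_v`, bad/good; per `w | v` of
`F_tpd`: `e_{w/v}, f_{w/v}, d_w`; `Σ_{w|v} e_{w/v} f_{w/v} = [F_tpd:F_mod]`), plus the Step (iii) inputs
(`StepIIITower`): Prop. 1.3 (i) over `ℚ_p` at each `w` (`d_w ≥ (e_w − 1)/e_w`, `e_w = e_v e_{w/v}`), "`d_w > 0 ⟹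
e_w ≥ 2`", and (D6) with the witness place `v` either bad or with ALL `w | v` ramified over `ℚ` (conjugate places
of the Galois extension `F_tpd/F_mod` ramify together). PROVED: `half_n_logp_le_topTerm` (the local inequality
behind the factor `2`: a witness `v` contributes `≥ ([F_tpd:F_mod]/2)·log p` to `[F_tpd:F_mod]·d_mod·(log 𝔡^{F_tpd}
+ log 𝔣^{F_tpd})` — bad: `Σ_w f_w e_w ≥ n`; ramified: `e_w − 1 ≥ e_w/2`), `sum_log_not_dvd_le`, and `logsQ_le`: `log(𝔰^ℚ) ≤ 2·d_mod·(log(𝔡^{F_tpd}) + log(𝔣^{F_tpd})) +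
log(2·3·5·l)` VERBATIM (the field `sQ_le` of `Thm110Numerics.ProofData`). Prop. 1.3 (i), Prop. 1.8 and
(D0)–(D6) themselves are inputs, not proved here; nothing on Cor. 3.12. This file SUPERSEDES the single-level
`Theorem110StepIII.lean` (`StepIIIData`, whose hypothesis `[F_tpd:ℚ] ≤ d_mod` restricts it to the degenerate case
`F_tpd = F_mod`; referee flag on p406813): here `d_mod = [F_mod:ℚ]` is the bottom degree and `[F_tpd:ℚ] =
[F_tpd:F_mod]·d_mod` as printed.
-/

noncomputable section

namespace Literature.IUT.LogVolume

namespace Thm110StepIII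

open Finset Real Thm110StepII

variable {V : Type*} [Fintype V] {W : V → Type*} [∀ v, Fintype (W v)]

/-- Step (iii) data: the place data of `F_tpd/F_mod` (`deg0 = d_mod`) together with the prime `l`, Prop. 1.3 (i)
over `ℚ_p` at each place of `F_tpd`, "different positive ⟹ ramified", and the distinguished primes with (D6).
[claim: Mochizuki2012, status: disputed] -/
structure StepIIITower (V : Type*) [Fintype V] (W : V → Type*) [∀ v, Fintype (W v)]
    extends PlaceData V W where
  /-- the prime `l` -/
  l : ℕ
  /-- `l ≥ 1` -/
  l_pos : 0 < l
  /-- the residue characteristics are primes -/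
  p_prime : ∀ v, (p v).Prime
  /-- `d_w ≥ 0` -/
  d_nonneg : ∀ v w, 0 ≤ d v w
  /-- Prop. 1.3 (i) over `ℚ_p`: `d_w ≥ (e_w − 1)/e_w`, `e_w = e_v·e_{w/v}` -/
  prop13i : ∀ v w, (((e0 v * erel v w : ℕ) : ℝ) - 1) / ((e0 v * erel v w : ℕ) : ℝ) ≤ d v w
  /-- `w ∈ Supp(𝔡^{F_tpd}_ADiv)` (i.e. `d_w > 0`) only if `w` is ramified over `ℚ` -/
  ramified_of_d_pos : ∀ v w, 0 < d v w → 2 ≤ e0 v * erel v w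
  /-- the distinguished rational primes `V_ℚ^dst` -/
  dst : Finset ℕ
  /-- they are primes -/
  dst_prime : ∀ q ∈ dst, q.Prime
  /-- (D6): a distinguished prime divides `2·3·5·l` or lies under a place `v` of `F_mod` that is under
  `Supp(𝔮^{F_tpd}_ADiv)` (bad) or under `Supp(𝔡^{F_tpd}_ADiv)` (then ALL `w | v` are ramified: `F_tpd/F_mod` Galois) -/
  D6 : ∀ q ∈ dst, q ∣ 2 * 3 * 5 * l ∨ ∃ v, p v = q ∧ (bad v = true ∨ ∀ w, 0 < d v w)

namespace StepIIITower

variable (T : StepIIITower V W)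

/-- `log(𝔰^ℚ) = Σ_{p ∈ V_ℚ^dst} log p`. [claim: Mochizuki2012, status: disputed] -/
def logsQ : ℝ := ∑ q ∈ T.dst, Real.log q

/-- `log p_v ≥ 0`. [folklore] -/
private theorem logp_nonneg' (v : V) : 0 ≤ T.logp v :=
  Real.log_nonneg (by exact_mod_cast (T.p_prime v).one_lt.le)

/-- The fundamental identity over `ℝ`. [folklore] -/
private theorem fund_real' (v : V) : ∑ w, ((T.erel v w : ℝ) * T.frel v w) = T.n := by
  have := T.fund v
  exact_mod_cast this

/-- `topTerm v ≥ 0`. [folklore] -/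
private theorem topTerm_nonneg (v : V) : 0 ≤ T.topTerm v := by
  unfold PlaceData.topTerm
  have hl := T.logp_nonneg' v
  have h1 : 0 ≤ ∑ w, T.locdeg v w * T.d v w * T.logp v :=
    Finset.sum_nonneg fun w _ => mul_nonneg (mul_nonneg (by unfold PlaceData.locdeg; positivity)
      (T.d_nonneg v w)) hl
  have h2 : 0 ≤ (if T.bad v then ∑ w, ((T.f0 v * T.frel v w : ℕ) : ℝ) * T.logp v else 0) := by
    split_ifs
    · exact Finset.sum_nonneg fun w _ => by positivity
    · exact le_rfl
  linarith

/-- Prop. 1.3 (i) in product form: `[L_w:ℚ_p]·d_w ≥ f_w·(e_w − 1)`. [claim: Mochizuki2012, status: disputed] -/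
theorem locdeg_mul_d_ge (v : V) (w : W v) :
    ((T.f0 v * T.frel v w : ℕ) : ℝ) * (((T.e0 v * T.erel v w : ℕ) : ℝ) - 1) ≤ T.locdeg v w * T.d v w := by
  have he : (0 : ℝ) < ((T.e0 v * T.erel v w : ℕ) : ℝ) := by
    exact_mod_cast Nat.mul_pos (T.e0_pos v) (T.erel_pos v w)
  have h13 := T.prop13i v w
  have h1 : (((T.e0 v * T.erel v w : ℕ) : ℝ) - 1) ≤ T.d v w * ((T.e0 v * T.erel v w : ℕ) : ℝ) := by
    have := mul_le_mul_of_nonneg_right h13 he.le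
    rwa [div_mul_cancel₀ _ he.ne'] at this
  have hf : (0 : ℝ) ≤ ((T.f0 v * T.frel v w : ℕ) : ℝ) := Nat.cast_nonneg _
  unfold PlaceData.locdeg
  nlinarith

/-- **The local inequality behind the factor `2`** (p. 26, "by considering the various possibilities"): a
witness place `v` of `F_mod` — bad, or with all `w | v` ramified over `ℚ` — satisfies
`([F_tpd:F_mod]/2)·log p_v ≤ topTerm v` (`topTerm v` = the `v`-part of `[F_tpd:F_mod]·d_mod·(log 𝔡^{F_tpd} +
log 𝔣^{F_tpd})`). [claim: Mochizuki2012, status: disputed] -/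
theorem half_n_logp_le_topTerm (v : V) (hv : T.bad v = true ∨ ∀ w, 0 < T.d v w) :
    (T.n : ℝ) / 2 * T.logp v ≤ T.topTerm v := by
  have hl := T.logp_nonneg' v
  have hfund := T.fund_real' v
  -- the different part dominates `Σ_w f_w (e_w − 1) · log p`
  have hdiff : (∑ w, ((T.f0 v * T.frel v w : ℕ) : ℝ) * (((T.e0 v * T.erel v w : ℕ) : ℝ) - 1)) * T.logp v ≤
      ∑ w, T.locdeg v w * T.d v w * T.logp v := by
    rw [Finset.sum_mul]
    exact Finset.sum_le_sum fun w _ => mul_le_mul_of_nonneg_right (T.locdeg_mul_d_ge v w) hl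
  unfold PlaceData.topTerm
  rcases hv with hb | hram
  · -- bad: `Σ_w f_w(e_w − 1) + Σ_w f_w = Σ_w f_w e_w ≥ Σ_w e_{w/v} f_{w/v} = n`
    rw [hb]; simp only [↓reduceIte]
    have hsum : (T.n : ℝ) ≤ ∑ w, (((T.f0 v * T.frel v w : ℕ) : ℝ) * (((T.e0 v * T.erel v w : ℕ) : ℝ) - 1)
        + ((T.f0 v * T.frel v w : ℕ) : ℝ)) := by
      rw [← hfund]
      refine Finset.sum_le_sum fun w _ => ?_
      have hf0 : (1 : ℝ) ≤ T.f0 v := by exact_mod_cast T.f0_pos v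
      have he0 : (1 : ℝ) ≤ T.e0 v := by exact_mod_cast T.e0_pos v
      have hfr : (0 : ℝ) ≤ T.frel v w := Nat.cast_nonneg _
      have her : (0 : ℝ) ≤ T.erel v w := Nat.cast_nonneg _
      push_cast
      nlinarith [mul_nonneg hfr her, mul_le_mul hf0 he0 zero_le_one (by linarith)]
    have hcond : ∑ w, ((T.f0 v * T.frel v w : ℕ) : ℝ) * T.logp v =
        (∑ w, ((T.f0 v * T.frel v w : ℕ) : ℝ)) * T.logp v := by rw [Finset.sum_mul]
    rw [hcond]
    rw [Finset.sum_add_distrib] at hsum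
    nlinarith
  · -- all `w | v` ramified: `e_w ≥ 2 ⟹ f_w(e_w − 1) ≥ f_w e_w/2 ≥ e_{w/v} f_{w/v}/2`
    have hsum : (T.n : ℝ) / 2 ≤ ∑ w, ((T.f0 v * T.frel v w : ℕ) : ℝ) * (((T.e0 v * T.erel v w : ℕ) : ℝ) - 1) := by
      rw [← hfund, Finset.sum_div]
      refine Finset.sum_le_sum fun w _ => ?_
      have he2 : (2 : ℝ) ≤ ((T.e0 v * T.erel v w : ℕ) : ℝ) := by exact_mod_cast T.ramified_of_d_pos v w (hram w)
      have hf0 : (1 : ℝ) ≤ T.f0 v := by exact_mod_cast T.f0_pos v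
      have he0 : (1 : ℝ) ≤ T.e0 v := by exact_mod_cast T.e0_pos v
      have hfr : (0 : ℝ) ≤ T.frel v w := Nat.cast_nonneg _
      have her : (0 : ℝ) ≤ T.erel v w := Nat.cast_nonneg _
      push_cast at he2 ⊢
      set E : ℝ := (T.e0 v : ℝ) * T.erel v w with hE
      set F : ℝ := (T.f0 v : ℝ) * T.frel v w with hF
      have h1 : E / 2 ≤ E - 1 := by linarith
      have hF0 : 0 ≤ F := by rw [hF]; positivity
      have h2 : F * (E / 2) ≤ F * (E - 1) := mul_le_mul_of_nonneg_left h1 hF0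
      have hfe : (T.erel v w : ℝ) * T.frel v w ≤ F * E := by
        rw [hF, hE]
        have hprod : 0 ≤ (T.erel v w : ℝ) * T.frel v w := mul_nonneg her hfr
        nlinarith [mul_le_mul hf0 he0 zero_le_one (by linarith : (0:ℝ) ≤ T.f0 v)]
      calc (T.erel v w : ℝ) * T.frel v w / 2 ≤ F * E / 2 := by linarith
        _ = F * (E / 2) := by ring
        _ ≤ F * (E - 1) := h2
        _ = (T.f0 v : ℝ) * T.frel v w * ((T.e0 v : ℝ) * T.erel v w - 1) := by rw [hF, hE]
    have hcond : 0 ≤ (if T.bad v then ∑ w, ((T.f0 v * T.frel v w : ℕ) : ℝ) * T.logp v else 0) := by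
      split_ifs
      · exact Finset.sum_nonneg fun w _ => by positivity
      · exact le_rfl
    nlinarith

/-- Generic: the primes of a finite set `S` that divide `N > 0` have `Σ log q ≤ log N`. [folklore] -/
private theorem sum_log_filter_dvd_le (S : Finset ℕ) (hS : ∀ q ∈ S, q.Prime) {N : ℕ} (hN : 0 < N) :
    ∑ q ∈ S.filter (fun q => q ∣ N), Real.log q ≤ Real.log N := by
  have hdvd : ∏ q ∈ S.filter (fun q => q ∣ N), q ∣ N :=
    Finset.prod_primes_dvd _ (fun q hq => (hS q (Finset.mem_filter.mp hq).1).prime)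
      (fun q hq => (Finset.mem_filter.mp hq).2)
  have hle : ((∏ q ∈ S.filter (fun q => q ∣ N), q : ℕ) : ℝ) ≤ N := by exact_mod_cast Nat.le_of_dvd hN hdvd
  have hpos : ∀ q ∈ S.filter (fun q => q ∣ N), (0 : ℝ) < q := fun q hq =>
    by exact_mod_cast (hS q (Finset.mem_filter.mp hq).1).pos
  rw [← Real.log_prod (fun q hq => (hpos q hq).ne')]
  push_cast at hle ⊢
  exact Real.log_le_log (Finset.prod_pos hpos) hle

/-- The distinguished primes not dividing `2·3·5·l` contribute `≤ (2/[F_tpd:F_mod])·Σ_v topTerm v =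
2·d_mod·(log 𝔡^{F_tpd} + log 𝔣^{F_tpd})`. [claim: Mochizuki2012, status: disputed] -/
theorem sum_log_not_dvd_le :
    ∑ q ∈ T.dst.filter (fun q => ¬ q ∣ 2 * 3 * 5 * T.l), Real.log q ≤
      2 / (T.n : ℝ) * ∑ v, T.topTerm v := by
  classical
  have hn : (0 : ℝ) < T.n := by exact_mod_cast T.n_pos
  set D' := T.dst.filter (fun q => ¬ q ∣ 2 * 3 * 5 * T.l) with hD'
  have hq : ∀ q ∈ D', Real.log q ≤ 2 / (T.n : ℝ) * ∑ v ∈ Finset.univ.filter (fun v => T.p v = q), T.topTerm v := by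
    intro q hq
    obtain ⟨hqd, hnd⟩ := Finset.mem_filter.mp hq
    rcases T.D6 q hqd with h | ⟨v, hv, hcase⟩
    · exact absurd h hnd
    · have hvmem : v ∈ Finset.univ.filter (fun v => T.p v = q) := by simp [hv]
      have hloc := T.half_n_logp_le_topTerm v hcase
      have hsingle : T.topTerm v ≤ ∑ v ∈ Finset.univ.filter (fun v => T.p v = q), T.topTerm v :=
        Finset.single_le_sum (fun w _ => T.topTerm_nonneg w) hvmem
      have hlogq : Real.log q = T.logp v := by unfold PlaceData.logp; rw [hv]
      rw [hlogq]
      have : T.logp v ≤ 2 / (T.n : ℝ) * T.topTerm v := by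
        rw [div_mul_eq_mul_div, le_div_iff₀ hn]
        linarith
      exact this.trans (mul_le_mul_of_nonneg_left hsingle (by positivity))
  calc ∑ q ∈ D', Real.log q
      ≤ ∑ q ∈ D', 2 / (T.n : ℝ) * ∑ v ∈ Finset.univ.filter (fun v => T.p v = q), T.topTerm v :=
        Finset.sum_le_sum hq
    _ = 2 / (T.n : ℝ) * ∑ q ∈ D', ∑ v ∈ (Finset.univ.filter (fun v => T.p v ∈ D')).filter (fun v => T.p v = q),
          T.topTerm v := by
        rw [Finset.mul_sum]
        refine Finset.sum_congr rfl fun q hqD => ?_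
        congr 1
        refine Finset.sum_congr ?_ fun _ _ => rfl
        ext v; simp only [Finset.mem_filter, Finset.mem_univ, true_and]
        constructor
        · intro h; exact ⟨by rw [h]; exact hqD, h⟩
        · intro h; exact h.2
    _ = 2 / (T.n : ℝ) * ∑ v ∈ Finset.univ.filter (fun v => T.p v ∈ D'), T.topTerm v := by
        rw [Finset.sum_fiberwise_of_maps_to (fun v hv => (Finset.mem_filter.mp hv).2) T.topTerm]
    _ ≤ 2 / (T.n : ℝ) * ∑ v, T.topTerm v :=
        mul_le_mul_of_nonneg_left (Finset.sum_le_sum_of_subset_of_nonneg (Finset.filter_subset _ _)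
          (fun v _ _ => T.topTerm_nonneg v)) (by positivity)

/-- **Step (iii), as printed (p. 26)**: `log(𝔰^ℚ) ≤ 2·d_mod·(log(𝔡^{F_tpd}) + log(𝔣^{F_tpd})) + log(2·3·5·l)`, with
`d_mod = [F_mod : ℚ] = deg0` and the `F_tpd`-quantities `logDiff`, `logCond` of the place data — the field
`sQ_le` of `Thm110Numerics.ProofData`. [claim: Mochizuki2012, status: disputed] -/
theorem logsQ_le : T.logsQ ≤ 2 * T.deg0 * (T.logDiff + T.logCond) + Real.log (2 * 3 * 5 * (T.l : ℝ)) := by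
  classical
  have hsplit : T.logsQ = (∑ q ∈ T.dst.filter (fun q => q ∣ 2 * 3 * 5 * T.l), Real.log q) +
      ∑ q ∈ T.dst.filter (fun q => ¬ q ∣ 2 * 3 * 5 * T.l), Real.log q := by
    unfold logsQ; rw [Finset.sum_filter_add_sum_filter_not]
  have hN : 0 < 2 * 3 * 5 * T.l := by have := T.l_pos; omega
  have h1 := sum_log_filter_dvd_le T.dst T.dst_prime hN
  have h1' : ∑ q ∈ T.dst.filter (fun q => q ∣ 2 * 3 * 5 * T.l), Real.log q ≤ Real.log (2 * 3 * 5 * (T.l : ℝ)) := by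
    have e : ((2 * 3 * 5 * T.l : ℕ) : ℝ) = 2 * 3 * 5 * (T.l : ℝ) := by push_cast; ring
    rw [← e]; exact h1
  have h2 := T.sum_log_not_dvd_le
  have htop : ∑ v, T.topTerm v = T.deg * (T.logDiff + T.logCond) := (T.deg_mul_top).symm
  have hn : (0 : ℝ) < T.n := by exact_mod_cast T.n_pos
  have hkey : 2 / (T.n : ℝ) * ∑ v, T.topTerm v = 2 * T.deg0 * (T.logDiff + T.logCond) := by
    rw [htop]; unfold PlaceData.deg; field_simp
  rw [hsplit]
  linarith

end StepIIITower

end Thm110StepIII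

end Literature.IUT.LogVolume

end
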